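import Literature.Computability.QuantumComplexity.CertificationSampleComplexity
import Literature.InformationTheory.Entanglement.TwoCopySwapPurity
import Mathlib.LinearAlgebra.Matrix.PosDef
import Mathlib.Analysis.RCLike.Basic
import HarnessLib

/-!
# Relative `ε̃`-approximate spherical 2-designs: eq. (33)–(34) and Theorem 7(b) of
# Hangleiter–Kliesch–Eisert–Gogolin for approximate designs

Companion of `CertificationSampleComplexity.lean` (Theorem 7(b) for EXACT state 2-designs,
`twoDesign_certification_lower_bound`, hypothesis (33) discharged with `ε̃ = 0`) and of
`DesignAnticoncentration.lean` (`IsStateTwoDesign`: `(1/K) Σ_j (|ψ_j⟩⟨ψ_j|)^{⊗2} = (𝟙 + F)/(N(N+1))`).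

Hangleiter et al. state Theorem 7(b) for “`ε̃`-approximate spherical 2-design sampling on `n` qubits,
and in particular, depth-`(O(n²) + O(n log 1/ε̃))` local random universal circuits”, and explain
(§V.B, p. 8–9): “The result of Theorem 7 applies to any circuit family `𝒰` such that `{U|S₀⟩}_{U∼𝒰}`
forms a relative `ε̃`-approximate spherical 2-design, for which the second moments are upper bounded
as in Eq. (33)”, `𝔼_{U∼μ}[|⟨S|U|S₀⟩|⁴] ≤ 2(1 + ε̃)/(|E_n|(|E_n| + 1))` (33), “This is provably true for
the local random universal circuits investigated by Brandão, Harrow, and Horodecki [48] by the fact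
that the resulting circuit family forms a relative `ε̃`-approximate unitary 2-design”.  The word
*relative* refers to Brandão–Harrow–Horodecki's multiplicative notion [BrandaoHarrowHorodecki2016,
Definition 2]: “`ν` is an `ε`-approximate unitary `t`-design if
`(1 − ε) Δ_{μ_Haar,t} ≼ Δ_{ν,t} ≼ (1 + ε) Δ_{μ_Haar,t}`” (complete-positivity order of the `t`-fold
twirling channels), whose point is that “for any state on `t` systems that is acted upon by a random
`U^{⊗t}` and then measured, the probability of any measurement outcome will change by only a small
multiplicative factor whether `U` is drawn from `ν` or the Haar measure”.

## What is formalised (finite state families `ψ : J → V → ℂ`, uniform weights `1/K`, `N = |V|`)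

* `avgTwoCopy ψ = (1/K) Σ_j (|ψ_j⟩⟨ψ_j|)^{⊗2}`, `haarTwoCopy V = (𝟙 + F)/(N(N+1))` (`= P_[2]/D_[2]`, the
  Haar / exact-design value of `DesignAnticoncentration.IsStateTwoDesign`), and
  `IsRelApproxStateTwoDesign ε̃ ψ`: unit vectors with
  `(1 − ε̃)·haarTwoCopy ≼ avgTwoCopy ψ ≼ (1 + ε̃)·haarTwoCopy` in the Loewner order
  (`Matrix.PosSemidef` of the two differences; `isRelApproxStateTwoDesign_iff` is the same sandwich
  written with Mathlib's scoped `MatrixOrder` `≤`).  This is Definition 2 of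
  [BrandaoHarrowHorodecki2016] at `t = 2` evaluated on the input `(|S₀⟩⟨S₀|)^{⊗2}` — i.e. the property
  of the state family `{U|S₀⟩}` that Hangleiter et al. call a relative `ε̃`-approximate spherical
  2-design (a completely positive order on channels passes to the Loewner order of their outputs, and
  `Δ_{μ_Haar,2}((|S₀⟩⟨S₀|)^{⊗2}) = P_[2]/D_[2]`).
* sanity: `isRelApproxStateTwoDesign_zero_iff` (`ε̃ = 0` ⇔ exact 2-design), `IsStateTwoDesign.isRelApprox`
  (exact ⇒ relative `ε̃`-approximate for every `ε̃ ≥ 0`), `IsRelApproxStateTwoDesign.mono`,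
  `haarTwoCopy_posSemidef` (`𝟙 + F = ½(𝟙 + F)†(𝟙 + F)`), and BHH's “multiplicative factor” remark as
  `quadForm_le` / `quadForm_ge`: `(1 − ε̃)⟨v|Haar|v⟩ ≤ ⟨v|M|v⟩ ≤ (1 + ε̃)⟨v|Haar|v⟩`.
* **eq. (33)** `IsRelApproxStateTwoDesign.fourth_moment_le`: `(1/K) Σ_j |⟨x|ψ_j⟩|⁴ ≤ 2(1+ε̃)/(N(N+1))`
  (the `(xx,xx)` diagonal entry of the upper sandwich), its lower companion `fourth_moment_ge`, and
  the summed form `second_moment_le`: `Σ_j (1/K) Σ_S P_j(S)² ≤ 2(1+ε̃)/N`.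
* **eq. (34)** `IsRelApproxStateTwoDesign.minEntropy_tail`: for every `δ > 0`, the fraction of `j`
  with `H_∞(P_j) < ½(log₂ N + log₂(δ/(2(1+ε̃))))` is at most `δ` (Lemma 5 of the paper, via
  `Certification.minEntropy_tail_of_second_moment`).
* **Theorem 7(b) for relative approximate designs** `approxDesign_certification_lower_bound`
  (modulo Valiant–Valiant's Theorem 2, hypothesis `hVV`, exactly as in the exact-design theorem):
  at most a `δ`-fraction of the `ψ_j` admit an `ε`-certification test from fewer than
  `c₂ · 2^{(log₂N)/4} (δ/(2(1+ε̃)))^{1/4} (1 − 2ε − 2^{−(log₂N)/2}(δ/(2(1+ε̃)))^{−1/2})^{3/2} / ε²`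
  samples — eq. (28) `2^{n/4}δ^{1/4}/(ϵ²(1+ε̃)^{1/4})` with the constant `2^{−1/4}` and the
  `(1 − 2ϵ − 2^{−H_∞})^{3/2}` factor kept explicit (hypothesis `hfit`, “for sufficiently large `n`”);
  and the HYPOTHESIS-FREE version `approxDesign_certification_lower_bound_flat` (`c₂ = 1/8`,
  `0 < ε ≤ 1/2`) for design states whose output distributions are flat on their supports, via the
  tree's `vvLowerBoundAt_flatOn_of_nonempty`.

* **(v2) Theorem 5 of Hangleiter–Bermejo-Vega–Schwarz–Eisert [HangleiterEtAl2018] for relative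
  approximate STATE 2-designs** `IsRelApproxStateTwoDesign.anticoncentration`: for `0 ≤ ε̃ < 1`,
  `0 ≤ α ≤ 1`, every outcome `x`, the fraction of `j` with `|⟨x|ψ_j⟩|² > α(1−ε̃)/N` is at least
  `(1−α)²(1−ε̃)²/(2(1+ε̃))` — `DesignAnticoncentration.anticoncentration_of_moment_bounds` with both
  moment hypotheses discharged from the definition (`second_moment_ge_at` / `second_moment_le_at`:
  a relative 2-design is a relative 1-design, `(1∓ε̃)/N` brackets `(1/K)Σ_j|⟨x|ψ_j⟩|²`, by summing the
  diagonal of the sandwich over the second copy; `fourth_moment_le`), closing that file's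
  “TODO(general form)” for the operator-inequality Definition 3.
* **(v3) Theorem 7(b) for relative approximate designs, UNCONDITIONAL**
  `approxDesign_certification_lower_bound_holds` (`c₂ = 1/11`, `|V| ≥ 2`): the Valiant–Valiant hypothesis
  `hVV` of `approxDesign_certification_lower_bound` is supplied by the tree's
  `Certification.vvLowerBoundAt_holds` (v11 of `CertificationSampleComplexity.lean`, through
  `Literature/Probability/HypothesisTesting/IdentityTestingLowerBound.lean`), and `ε ≤ 1/2` is read off
  `hfit`; no hypothesis beyond the design property and “sufficiently large `n`” remains.

NOT formalised: Brandão–Harrow–Horodecki's Corollary 6 / Theorem 5 (local random circuits of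
length `O(n(n + log 1/ε))` ARE relative `ε`-approximate 2-designs) — the external input that turns
the theorems below into statements about random universal circuits; and the channel (unitary-design)
form of their Definition 2 itself (only its consequence for the state family is used, as in the paper).

HONEST FRAMING (pub-qadeq register): ‘instance-level adjudication of specific advantage claims;
no claim about BQP vs BPP or the summit’.  This file proves published statements about finite
state ensembles; it makes no statement about any device or experiment.

## References
* [HangleiterEtAl2019] D. Hangleiter, M. Kliesch, J. Eisert, C. Gogolin, *Sample complexity of
  device-independently certified “quantum supremacy”*, Phys. Rev. Lett. 122, 210502 (2019),
  arXiv:1812.01023 — Theorem 7(b) eq. (28) p. 8; §V.B eqs. (32)–(34) p. 9.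
* [BrandaoHarrowHorodecki2016] F. G. S. L. Brandão, A. W. Harrow, M. Horodecki, *Local random
  quantum circuits are approximate polynomial-designs*, Commun. Math. Phys. 346, 397–434 (2016),
  arXiv:1208.0692 — §1.1 Definition 2; §2.1 Corollary 6.
* [HangleiterEtAl2018] D. Hangleiter, J. Bermejo-Vega, M. Schwarz, J. Eisert, *Anticoncentration
  theorems for schemes showing a quantum speedup*, Quantum 2, 65 (2018), arXiv:1706.03786 — §3
  Definition 3 (relative ϵ-approximate unitary k-design), Theorem 5 and the remark after it.
* [ZhuEtAl2016] H. Zhu, R. Kueng, M. Grassl, D. Gross, *The Clifford group fails gracefully to be a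
  unitary 4-design*, arXiv:1609.08172 — §2 Proposition 1 (`P_[t]/D_[t]`).
-/

namespace Literature.Computability.QuantumComplexity
namespace ApproximateStateDesign

open Matrix Finset DesignAnticoncentration Certification
open scoped Kronecker ComplexConjugate ComplexOrder BigOperators

variable {V : Type*} [Fintype V] [DecidableEq V] {J : Type*} [Fintype J]

/-! ### The definition -/

/-- The two-copy ensemble average `M(ψ) = (1/K) Σ_j (|ψ_j⟩⟨ψ_j|)^{⊗2}` of a finite family of vectors
(uniform weights `1/K`, `K = |J|`) — the left-hand side of the design identity.
[cite: ZhuEtAl2016, §2 Proposition 1 (“(1/K)Σ_j (|ψ_j⟩⟨ψ_j|)^{⊗t}”)] [cite: HangleiterEtAl2019, §V.B eq. (33) (“𝔼_{U∼μ}[|⟨S|U|S₀⟩|⁴]” is its `(SS,SS)` entry), p. 9] -/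
noncomputable def avgTwoCopy (ψ : J → V → ℂ) : Matrix (V × V) (V × V) ℂ :=
  ((Fintype.card J : ℂ))⁻¹ • ∑ j, proj (ψ j) ⊗ₖ proj (ψ j)

/-- The Haar (exact 2-design) value of the two-copy average, `P_[2]/D_[2] = (𝟙 + F)/(N(N+1))`
(`N = |V|`, `F` the swap). [cite: ZhuEtAl2016, §2 Proposition 1 (“P_[t]/D_[t]”, `D_[2] = N(N+1)/2`)] [cite: HangleiterEtAl2019, §V.B eq. (32) (“E_{p∼P_PT}[p²] = 2/(|E_n|(|E_n|+1))”), p. 9] -/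
noncomputable def haarTwoCopy (V : Type*) [Fintype V] [DecidableEq V] : Matrix (V × V) (V × V) ℂ :=
  (((Fintype.card V : ℂ)) * (Fintype.card V + 1))⁻¹ • ((1 : Matrix (V × V) (V × V) ℂ) + swapOp V)

/-- **Relative `ε̃`-approximate spherical (complex-projective, state) 2-design**: a finite family
`{ψ_j}_{j∈J}` of unit vectors in `ℂ^V` whose two-copy average is sandwiched multiplicatively around
the Haar value, `(1 − ε̃)·(𝟙 + F)/(N(N+1)) ≼ (1/K) Σ_j (|ψ_j⟩⟨ψ_j|)^{⊗2} ≼ (1 + ε̃)·(𝟙 + F)/(N(N+1))`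
in the Loewner order — Brandão–Harrow–Horodecki's Definition 2 (“`ν` is an `ε`-approximate unitary
`t`-design if `(1 − ε)Δ_{μ_Haar,t} ≼ Δ_{ν,t} ≼ (1 + ε)Δ_{μ_Haar,t}`”) at `t = 2`, evaluated on the input
`(|S₀⟩⟨S₀|)^{⊗2}` for the state family `ψ_j = U_j|S₀⟩`, which is the property Hangleiter et al. use
(“any circuit family `𝒰_n` on `n` qubits such that `{U|0⟩}_{U∼𝒰_n}` forms a relative `ε̃`-approximate
spherical 2-design”).
[cite: BrandaoHarrowHorodecki2016, §1.1 Definition 2] [cite: HangleiterEtAl2019, §V.B (text between eqs. (33) and (34)), p. 9] -/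
structure IsRelApproxStateTwoDesign (εd : ℝ) (ψ : J → V → ℂ) : Prop where
  /-- every `ψ_j` is a unit vector -/
  norm_sq : ∀ j, ∑ a, Complex.normSq (ψ j a) = 1
  /-- upper sandwich: `(1 + ε̃)·Haar − M ≽ 0` -/
  upper : (((1 + εd : ℝ) : ℂ) • haarTwoCopy V - avgTwoCopy ψ).PosSemidef
  /-- lower sandwich: `M − (1 − ε̃)·Haar ≽ 0` -/
  lower : (avgTwoCopy ψ - ((1 - εd : ℝ) : ℂ) • haarTwoCopy V).PosSemidef

/-- The tree's exact 2-design property, rephrased: unit vectors with `M(ψ) = (𝟙 + F)/(N(N+1))`.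
[cite: ZhuEtAl2016, §2 Definition 1 and Proposition 1] -/
theorem isStateTwoDesign_iff (ψ : J → V → ℂ) :
    IsStateTwoDesign ψ ↔ (∀ j, ∑ a, Complex.normSq (ψ j a) = 1) ∧ avgTwoCopy ψ = haarTwoCopy V :=
  ⟨fun h => ⟨h.norm_sq, h.tensor_two⟩, fun h => ⟨h.1, h.2⟩⟩

section loewner
open scoped MatrixOrder

/-- **The definition in Loewner notation** (Mathlib's scoped `MatrixOrder`: `A ≤ B ↔ (B − A) ≽ 0`):
`(1 − ε̃)·Haar ≤ M(ψ) ≤ (1 + ε̃)·Haar`, the shape of “`(1 − ε)Δ_{μ_Haar,t} ≼ Δ_{ν,t} ≼ (1 + ε)Δ_{μ_Haar,t}`”.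
[cite: BrandaoHarrowHorodecki2016, §1.1 Definition 2] -/
theorem isRelApproxStateTwoDesign_iff (εd : ℝ) (ψ : J → V → ℂ) :
    IsRelApproxStateTwoDesign εd ψ ↔
      (∀ j, ∑ a, Complex.normSq (ψ j a) = 1) ∧
        ((1 - εd : ℝ) : ℂ) • haarTwoCopy V ≤ avgTwoCopy ψ ∧
          avgTwoCopy ψ ≤ ((1 + εd : ℝ) : ℂ) • haarTwoCopy V := by
  rw [Matrix.le_iff, Matrix.le_iff]
  exact ⟨fun h => ⟨h.norm_sq, h.lower, h.upper⟩, fun h => ⟨h.1, h.2.2, h.2.1⟩⟩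

/-- **`ε̃ = 0` is an exact 2-design** (antisymmetry of the Loewner order) and conversely.
[cite: BrandaoHarrowHorodecki2016, §1.1 (Definition 2 with `ε = 0` is the Haar twirl, “G(ν,t) denote the smallest ε”)] [cite: ZhuEtAl2016, §2 Proposition 1] -/
theorem isRelApproxStateTwoDesign_zero_iff (ψ : J → V → ℂ) :
    IsRelApproxStateTwoDesign 0 ψ ↔ IsStateTwoDesign ψ := by
  rw [isRelApproxStateTwoDesign_iff, isStateTwoDesign_iff, sub_zero, add_zero, Complex.ofReal_one,
    one_smul]
  exact ⟨fun h => ⟨h.1, le_antisymm h.2.2 h.2.1⟩, fun h => ⟨h.1, h.2.ge, h.2.le⟩⟩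

end loewner

/-! ### Positivity of the Haar value; exact designs; monotonicity in `ε̃` -/

/-- Nonnegative real multiples of positive semidefinite complex matrices are positive semidefinite. [folklore] -/
private theorem posSemidef_real_smul {n : Type*} [Fintype n] {M : Matrix n n ℂ} (hM : M.PosSemidef)
    {r : ℝ} (hr : 0 ≤ r) : (((r : ℝ) : ℂ) • M).PosSemidef :=
  hM.smul (Complex.zero_le_real.2 hr)

open Literature.InformationTheory.Entanglement.TwoCopy in
/-- `𝟙 + F ≽ 0`: indeed `(𝟙 + F)†(𝟙 + F) = 2(𝟙 + F)` since `F† = F`, `F² = 𝟙` (`(𝟙 + F)/2 = P_[2]` is the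
projector onto the symmetric subspace). [cite: ZhuEtAl2016, §2 (“with corresponding projector P_[t]”)] -/
theorem one_add_swapOp_posSemidef :
    ((1 : Matrix (V × V) (V × V) ℂ) + swapOp V).PosSemidef := by
  have hsq : ((1 : Matrix (V × V) (V × V) ℂ) + swapOp V)ᴴ * (1 + swapOp V) =
      (2 : ℂ) • (1 + swapOp V) := by
    rw [conjTranspose_add, conjTranspose_one, conjTranspose_swapOp, add_mul, mul_add, mul_add,
      one_mul, mul_one, one_mul, swapOp_mul_swapOp, two_smul]
    abel
  have h2 : (1 : Matrix (V × V) (V × V) ℂ) + swapOp V =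
      (((1 / 2 : ℝ)) : ℂ) • (((1 : Matrix (V × V) (V × V) ℂ) + swapOp V)ᴴ * (1 + swapOp V)) := by
    rw [hsq, smul_smul]; push_cast
    rw [show (1 / 2 : ℂ) * 2 = 1 by norm_num, one_smul]
  rw [h2]
  exact posSemidef_real_smul (posSemidef_conjTranspose_mul_self _) (by norm_num)

/-- The Haar value `(𝟙 + F)/(N(N+1))` is positive semidefinite. [cite: ZhuEtAl2016, §2 Proposition 1 (`P_[t]/D_[t]`, a scaled projector)] -/
theorem haarTwoCopy_posSemidef : (haarTwoCopy V).PosSemidef := by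
  unfold haarTwoCopy
  have : (((Fintype.card V : ℂ)) * (Fintype.card V + 1))⁻¹ =
      (((((Fintype.card V : ℝ)) * (Fintype.card V + 1))⁻¹ : ℝ) : ℂ) := by push_cast; rfl
  rw [this]
  exact posSemidef_real_smul one_add_swapOp_posSemidef (by positivity)

/-- **An exact 2-design is a relative `ε̃`-approximate 2-design for every `ε̃ ≥ 0`** (then
`(1 + ε̃)·Haar − M = ε̃·Haar ≽ 0` and `M − (1 − ε̃)·Haar = ε̃·Haar ≽ 0`).
[cite: BrandaoHarrowHorodecki2016, §1.1 Definition 2] [cite: HangleiterEtAl2019, Theorem 7(b) (eq. (28) at `ε̃ = 0` is the exact-design case of `twoDesign_certification_lower_bound`), p. 8] -/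
theorem _root_.Literature.Computability.QuantumComplexity.DesignAnticoncentration.IsStateTwoDesign.isRelApprox
    {ψ : J → V → ℂ} (h : IsStateTwoDesign ψ) {εd : ℝ} (hεd : 0 ≤ εd) :
    IsRelApproxStateTwoDesign εd ψ where
  norm_sq := h.norm_sq
  upper := by
    rw [show avgTwoCopy ψ = haarTwoCopy V from h.tensor_two, Complex.ofReal_add, Complex.ofReal_one,
      add_smul, one_smul, add_sub_cancel_left]
    exact posSemidef_real_smul haarTwoCopy_posSemidef hεd
  lower := by
    rw [show avgTwoCopy ψ = haarTwoCopy V from h.tensor_two, Complex.ofReal_sub, Complex.ofReal_one,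
      sub_smul, one_smul, sub_sub_cancel]
    exact posSemidef_real_smul haarTwoCopy_posSemidef hεd

/-- **Monotonicity**: a relative `ε̃`-approximate 2-design is a relative `ε̃'`-approximate one for
every `ε̃' ≥ ε̃` (“let `G(ν,t)` denote the smallest `ε` for which (the definition) holds”).
[cite: BrandaoHarrowHorodecki2016, §1.1 Definition 2] -/
theorem IsRelApproxStateTwoDesign.mono {ψ : J → V → ℂ} {εd εd' : ℝ}
    (h : IsRelApproxStateTwoDesign εd ψ) (hle : εd ≤ εd') : IsRelApproxStateTwoDesign εd' ψ where
  norm_sq := h.norm_sq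
  upper := by
    have e : ((1 + εd' : ℝ) : ℂ) • haarTwoCopy V - avgTwoCopy ψ =
        (((1 + εd : ℝ) : ℂ) • haarTwoCopy V - avgTwoCopy ψ) + ((εd' - εd : ℝ) : ℂ) • haarTwoCopy V := by
      rw [sub_add_eq_add_sub, ← add_smul, ← Complex.ofReal_add,
        show 1 + εd + (εd' - εd) = 1 + εd' by ring]
    rw [e]
    exact h.upper.add (posSemidef_real_smul haarTwoCopy_posSemidef (sub_nonneg.2 hle))
  lower := by
    have e : avgTwoCopy ψ - ((1 - εd' : ℝ) : ℂ) • haarTwoCopy V =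
        (avgTwoCopy ψ - ((1 - εd : ℝ) : ℂ) • haarTwoCopy V) + ((εd' - εd : ℝ) : ℂ) • haarTwoCopy V := by
      rw [sub_add, ← sub_smul, ← Complex.ofReal_sub,
        show 1 - εd - (εd' - εd) = 1 - εd' by ring]
    rw [e]
    exact h.lower.add (posSemidef_real_smul haarTwoCopy_posSemidef (sub_nonneg.2 hle))

/-! ### “The probability of any measurement outcome changes by only a small multiplicative factor” -/

/-- For every `v ∈ ℂ^{V×V}`: `⟨v|M(ψ)|v⟩ ≤ (1 + ε̃)·⟨v|Haar|v⟩` (in `ℂ` with its real-part order; both sides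
are real). [cite: BrandaoHarrowHorodecki2016, §1.1 (remark after Definition 2: “the probability of any measurement outcome will change by only a small multiplicative factor whether U is drawn from ν or the Haar measure”)] -/
theorem IsRelApproxStateTwoDesign.quadForm_le {ψ : J → V → ℂ} {εd : ℝ}
    (h : IsRelApproxStateTwoDesign εd ψ) (v : V × V → ℂ) :
    star v ⬝ᵥ (avgTwoCopy ψ *ᵥ v) ≤ ((1 + εd : ℝ) : ℂ) * (star v ⬝ᵥ (haarTwoCopy V *ᵥ v)) := by
  have h0 := h.upper.dotProduct_mulVec_nonneg v
  rw [sub_mulVec, dotProduct_sub, smul_mulVec, dotProduct_smul, smul_eq_mul] at h0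
  exact sub_nonneg.1 h0

/-- … and `(1 − ε̃)·⟨v|Haar|v⟩ ≤ ⟨v|M(ψ)|v⟩`. [cite: BrandaoHarrowHorodecki2016, §1.1 (remark after Definition 2)] -/
theorem IsRelApproxStateTwoDesign.quadForm_ge {ψ : J → V → ℂ} {εd : ℝ}
    (h : IsRelApproxStateTwoDesign εd ψ) (v : V × V → ℂ) :
    ((1 - εd : ℝ) : ℂ) * (star v ⬝ᵥ (haarTwoCopy V *ᵥ v)) ≤ star v ⬝ᵥ (avgTwoCopy ψ *ᵥ v) := by
  have h0 := h.lower.dotProduct_mulVec_nonneg v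
  rw [sub_mulVec, dotProduct_sub, smul_mulVec, dotProduct_smul, smul_eq_mul] at h0
  exact sub_nonneg.1 h0

/-! ### Eq. (33): fourth moments of a relative approximate 2-design -/

omit [Fintype V] [DecidableEq V] in
/-- Diagonal entries of `|φ⟩⟨φ| ⊗ |φ⟩⟨φ|`: `⟨a c|(|φ⟩⟨φ|)^{⊗2}|a c⟩ = |φ_a|²|φ_c|²`. [folklore] -/
private theorem proj_kron_diag' (φ : V → ℂ) (a c : V) :
    (proj φ ⊗ₖ proj φ) (a, c) (a, c) = ((Complex.normSq (φ a) * Complex.normSq (φ c) : ℝ) : ℂ) := by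
  rw [kroneckerMap_apply, proj, vecMulVec_apply, vecMulVec_apply]
  simp only [Pi.star_apply, Complex.star_def, Complex.mul_conj]
  push_cast; ring

omit [Fintype V] [DecidableEq V] in
/-- The `(xx,xx)` entry of `M(ψ)` is the fourth moment `(1/K) Σ_j |⟨x|ψ_j⟩|⁴`.
[cite: HangleiterEtAl2019, §V.B eq. (33) (left-hand side `𝔼_{U∼μ}[|⟨S|U|S₀⟩|⁴]`), p. 9] -/
theorem avgTwoCopy_diag (ψ : J → V → ℂ) (x : V) :
    avgTwoCopy ψ (x, x) (x, x) =
      ((((Fintype.card J : ℝ))⁻¹ * ∑ j, Complex.normSq (ψ j x) ^ 2 : ℝ) : ℂ) := by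
  rw [avgTwoCopy, Matrix.smul_apply, Matrix.sum_apply, smul_eq_mul]
  simp_rw [proj_kron_diag']
  push_cast
  simp_rw [sq]

/-- The `(xx,xx)` entry of the Haar value is `2/(N(N+1))` (`⟨xx|(𝟙 + F)|xx⟩ = 2`).
[cite: HangleiterEtAl2019, §V.B eq. (32) (`2/(|E_n|(|E_n|+1))`), p. 9] -/
theorem haarTwoCopy_diag (x : V) :
    haarTwoCopy V (x, x) (x, x) = ((2 / ((Fintype.card V : ℝ) * (Fintype.card V + 1)) : ℝ) : ℂ) := by
  rw [haarTwoCopy, Matrix.smul_apply, Matrix.add_apply, Matrix.one_apply_eq, swapOp, Matrix.of_apply,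
    if_pos ⟨rfl, rfl⟩, smul_eq_mul]
  push_cast
  ring

/-- **Eq. (33)**: for a relative `ε̃`-approximate spherical 2-design,
`(1/K) Σ_j |⟨x|ψ_j⟩|⁴ ≤ 2(1 + ε̃)/(N(N + 1))` for every outcome `x` (the `(xx,xx)` diagonal entry of
`(1 + ε̃)·Haar − M ≽ 0`). [cite: HangleiterEtAl2019, §V.B eq. (33) (“E_{U∼μ}[|⟨S|U|S₀⟩|⁴] ≤ 2(1+ε̃)/(|E_n|(|E_n|+1))” and “for any circuit family … such that {U|0⟩} forms a relative ε̃-approximate spherical 2-design, the second moments are bounded as in Eq. (33)”), p. 9] -/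
theorem IsRelApproxStateTwoDesign.fourth_moment_le {ψ : J → V → ℂ} {εd : ℝ}
    (h : IsRelApproxStateTwoDesign εd ψ) (x : V) :
    ((Fintype.card J : ℝ))⁻¹ * ∑ j, Complex.normSq (ψ j x) ^ 2 ≤
      2 * (1 + εd) / ((Fintype.card V : ℝ) * (Fintype.card V + 1)) := by
  have hd := h.upper.diag_nonneg (i := ((x, x) : V × V))
  rw [Matrix.sub_apply, Matrix.smul_apply, haarTwoCopy_diag, avgTwoCopy_diag, smul_eq_mul,
    ← Complex.ofReal_mul, ← Complex.ofReal_sub, Complex.zero_le_real] at hd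
  have : (1 + εd) * (2 / ((Fintype.card V : ℝ) * (Fintype.card V + 1))) =
      2 * (1 + εd) / ((Fintype.card V : ℝ) * (Fintype.card V + 1)) := by ring
  linarith

/-- The lower companion of (33): `2(1 − ε̃)/(N(N + 1)) ≤ (1/K) Σ_j |⟨x|ψ_j⟩|⁴`.
[cite: BrandaoHarrowHorodecki2016, §1.1 Definition 2 (lower sandwich `(1 − ε)Δ_{μ_Haar,t} ≼ Δ_{ν,t}`)] [cite: HangleiterEtAl2019, §V.B eq. (32), p. 9] -/
theorem IsRelApproxStateTwoDesign.fourth_moment_ge {ψ : J → V → ℂ} {εd : ℝ}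
    (h : IsRelApproxStateTwoDesign εd ψ) (x : V) :
    2 * (1 - εd) / ((Fintype.card V : ℝ) * (Fintype.card V + 1)) ≤
      ((Fintype.card J : ℝ))⁻¹ * ∑ j, Complex.normSq (ψ j x) ^ 2 := by
  have hd := h.lower.diag_nonneg (i := ((x, x) : V × V))
  rw [Matrix.sub_apply, Matrix.smul_apply, haarTwoCopy_diag, avgTwoCopy_diag, smul_eq_mul,
    ← Complex.ofReal_mul, ← Complex.ofReal_sub, Complex.zero_le_real] at hd
  have : (1 - εd) * (2 / ((Fintype.card V : ℝ) * (Fintype.card V + 1))) =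
      2 * (1 - εd) / ((Fintype.card V : ℝ) * (Fintype.card V + 1)) := by ring
  linarith

/-- A relative `ε̃`-approximate 2-design with `ε̃ < 1` on an inhabited `V` is non-empty (the lower
sandwich has a positive diagonal). [cite: BrandaoHarrowHorodecki2016, §1.1 Definition 2] -/
theorem IsRelApproxStateTwoDesign.card_pos {ψ : J → V → ℂ} {εd : ℝ}
    (h : IsRelApproxStateTwoDesign εd ψ) (hεd : εd < 1) (x : V) : 0 < Fintype.card J := by
  by_contra hK
  have hK0 : Fintype.card J = 0 := by omega
  have h1 := h.fourth_moment_ge x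
  rw [hK0, Nat.cast_zero, _root_.inv_zero, zero_mul] at h1
  have hN : (0 : ℝ) < Fintype.card V := by exact_mod_cast Fintype.card_pos_iff.2 ⟨x⟩
  have : 0 < 2 * (1 - εd) / ((Fintype.card V : ℝ) * (Fintype.card V + 1)) := by
    apply div_pos <;> nlinarith
  linarith

/-- **Eq. (33) summed over the outcomes**: the ensemble second moment of the output distributions
`P_j(S) = |⟨S|ψ_j⟩|²` obeys `Σ_j (1/K) Σ_S P_j(S)² ≤ N · 2(1+ε̃)/(N(N+1)) ≤ 2(1 + ε̃)/N`.
[cite: HangleiterEtAl2019, §V.B eqs. (32)–(33) and §IV.A (“the same second moment bound that is used to derive anti-concentration implies a high min-entropy”), p. 7, 9] -/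
theorem IsRelApproxStateTwoDesign.second_moment_le {ψ : J → V → ℂ} {εd : ℝ}
    (h : IsRelApproxStateTwoDesign εd ψ) (hεd : 0 ≤ εd) :
    ∑ j, ((Fintype.card J : ℝ))⁻¹ * ∑ S, designDist ψ j S ^ 2 ≤
      2 * (1 + εd) / (Fintype.card V : ℝ) := by
  have hN : (0 : ℝ) ≤ Fintype.card V := Nat.cast_nonneg _
  calc ∑ j, ((Fintype.card J : ℝ))⁻¹ * ∑ S, designDist ψ j S ^ 2
      = ∑ S : V, ((Fintype.card J : ℝ))⁻¹ * ∑ j, Complex.normSq (ψ j S) ^ 2 := by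
        simp_rw [mul_sum]; rw [sum_comm]; rfl
    _ ≤ ∑ _S : V, 2 * (1 + εd) / ((Fintype.card V : ℝ) * (Fintype.card V + 1)) :=
        sum_le_sum fun S _ => h.fourth_moment_le S
    _ = (Fintype.card V : ℝ) * (2 * (1 + εd) / ((Fintype.card V : ℝ) * (Fintype.card V + 1))) := by
        rw [sum_const, card_univ, nsmul_eq_mul]
    _ ≤ 2 * (1 + εd) / (Fintype.card V : ℝ) := by
        rcases hN.eq_or_lt with h0 | hpos
        · rw [← h0]; simp
        · rw [← mul_div_assoc, div_le_div_iff₀ (by positivity) hpos]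
          nlinarith

/-! ### Eq. (34) and Theorem 7(b) for relative approximate 2-designs -/

variable [Nonempty V] [Nonempty J]

/-- `Σ_j 1/K = 1`. [folklore] -/
private theorem unifWeight_sum : ∑ _j : J, ((Fintype.card J : ℝ))⁻¹ = 1 := by
  have hK : (0 : ℝ) < Fintype.card J := by exact_mod_cast Fintype.card_pos
  rw [sum_const, card_univ, nsmul_eq_mul, mul_inv_cancel₀ hK.ne']

open Classical in
/-- **Eq. (34): min-entropy tail for relative approximate 2-designs.** “For all such circuit families,
using Lemma 5, we thus obtain the min-entropy bound `H_∞(P_U) ≥ ½(n + log(δ/(2(1+ε̃))))` (34), which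
holds with probability at least `1 − δ` over the choice of `U`”: for every `δ > 0`, the fraction of
design states `ψ_j` whose output distribution has `H_∞(P_j) < ½(log₂ N + log₂(δ/(2(1+ε̃))))` is at most `δ`
(`n = log₂ N`). [cite: HangleiterEtAl2019, §V.B eq. (34) and Lemma 5, p. 7, 9] -/
theorem IsRelApproxStateTwoDesign.minEntropy_tail {ψ : J → V → ℂ} {εd : ℝ}
    (h : IsRelApproxStateTwoDesign εd ψ) (hεd : 0 ≤ εd) {δ : ℝ} (hδ : 0 < δ) :
    ((univ.filter fun j : J =>
        ¬ ((Real.logb 2 (Fintype.card V) + Real.logb 2 (δ / (2 * (1 + εd)))) / 2 ≤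
            minEntropy (designDist ψ j))).card : ℝ) / (Fintype.card J : ℝ) ≤ δ := by
  have hN : (0 : ℝ) < Fintype.card V := by exact_mod_cast Fintype.card_pos
  have L := minEntropy_tail_of_second_moment (ι := V)
    (fun _ : J => ((Fintype.card J : ℝ))⁻¹) (fun _ => by positivity) unifWeight_sum
    (designDist ψ) (fun j S => designDist_nonneg ψ j S) h.norm_sq hδ (h.second_moment_le hεd)
    (t := (Real.logb 2 (Fintype.card V) + Real.logb 2 (δ / (2 * (1 + εd)))) / 2) (by
      have h2 : (2 * (1 + εd)) ≠ 0 := by positivity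
      rw [Real.logb_div hδ.ne' h2, Real.logb_div h2 hN.ne']
      linarith)
  rw [sum_const, nsmul_eq_mul] at L
  rw [div_eq_mul_inv]
  exact L

open Classical in
/-- **Theorem 7(b) for a relative `ε̃`-approximate spherical 2-design, modulo Theorem 2 only — PROVED.**
For a finite relative `ε̃`-approximate state 2-design `{ψ_j}_{j∈J}` in `ℂ^V` (`N = |V|`, `ε̃ ≥ 0`),
uniform weights `1/K`, `0 < ε`, `0 < δ`, granted the Valiant–Valiant lower bound (Theorem 2) at accuracy
`ε` for each output distribution `P_j`: the fraction of design states whose `P_j` ADMITS an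
`ε`-certification test from fewer than
`c₂ · 2^{(log₂N)/4} (δ/(2(1+ε̃)))^{1/4} (1 − 2ε − 2^{−(log₂N)/2}(δ/(2(1+ε̃)))^{−1/2})^{3/2} / ε²` samples is
at most `δ` — eq. (28), `s_min ∈ Ω(2^{n/4}δ^{1/4}/(ϵ²(1+ε̃)^{1/4}))`, with the constant `2^{−1/4}` and the
`(1 − 2ϵ − 2^{−H_∞})^{3/2}` factor (dropped in the paper “for sufficiently large `n`”, here `hfit`) explicit.
Hypothesis (33) of the tree's `design_certification_lower_bound` is DISCHARGED by `fourth_moment_le`.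
[cite: HangleiterEtAl2019, Theorem 7(b) eq. (28) (“ε̃-approximate spherical 2-design sampling on n qubits”) and §V.B eqs. (33)–(34), p. 8–9] [cite: BrandaoHarrowHorodecki2016, §1.1 Definition 2] -/
theorem approxDesign_certification_lower_bound {ψ : J → V → ℂ} {εd : ℝ}
    (hψ : IsRelApproxStateTwoDesign εd ψ) (hεd : 0 ≤ εd)
    {c₂ ε δ : ℝ} (hc : 0 ≤ c₂) (hε : 0 < ε) (hδ : 0 < δ)
    (hfit : 2 * ε + (2 : ℝ) ^ (-Real.logb 2 (Fintype.card V) / 2) *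
      (δ / (2 * (1 + εd))) ^ (-(1 / 2) : ℝ) ≤ 1)
    (hVV : ∀ j, VVLowerBoundAt c₂ ε (designDist ψ j)) :
    ((univ.filter (fun j : J =>
        ¬ (∀ (s : ℕ) (T : (Fin s → V) → Bool), IsCertTest (designDist ψ j) ε s T →
          c₂ * ((2 : ℝ) ^ (Real.logb 2 (Fintype.card V) / 4) * (δ / (2 * (1 + εd))) ^ (1 / 4 : ℝ) *
            (1 - 2 * ε - (2 : ℝ) ^ (-Real.logb 2 (Fintype.card V) / 2) *
              (δ / (2 * (1 + εd))) ^ (-(1 / 2) : ℝ)) ^ (3 / 2 : ℝ)) / ε ^ 2 ≤ s))).card : ℝ) /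
      (Fintype.card J : ℝ) ≤ δ := by
  have hμ : ∀ _j : J, (0 : ℝ) ≤ ((Fintype.card J : ℝ))⁻¹ := fun _ => by positivity
  -- (33), from the upper sandwich
  have h33 : ∀ S : V, ∑ j, ((Fintype.card J : ℝ))⁻¹ * designDist ψ j S ^ 2 ≤
      2 * (1 + εd) / ((Fintype.card V : ℝ) * (Fintype.card V + 1)) := by
    intro S
    rw [← mul_sum]
    exact hψ.fourth_moment_le S
  have key := design_certification_lower_bound (fun _ : J => ((Fintype.card J : ℝ))⁻¹) hμ unifWeight_sum
    (designDist ψ) (fun j S => designDist_nonneg ψ j S) hψ.norm_sq hc hε hδ hεd h33 hfit hVV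
  simp only [sum_const, nsmul_eq_mul] at key
  rw [div_eq_mul_inv]
  exact key

open Classical in
/-- **Theorem 7(b), hypothesis-free, for relative approximate 2-designs with flat-on-support outputs**
(`c₂ = 1/8`, `0 < ε ≤ 1/2`, `|V| ≥ 2`): if every output distribution `P_j` is uniform on its support
(“quantum supremacy distributions are flat”, eq. (9)), then at most a `δ`-fraction of the `ψ_j` admit an
`ε`-certification test from fewer than
`(1/8)·2^{(log₂N)/4}(δ/(2(1+ε̃)))^{1/4}(1 − 2ε − 2^{−(log₂N)/2}(δ/(2(1+ε̃)))^{−1/2})^{3/2}/ε²` samples;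
Valiant–Valiant's Theorem 2 is no longer an input (the tree's `vvLowerBoundAt_flatOn_of_nonempty`).
[cite: HangleiterEtAl2019, Theorem 7(b) eq. (28), §IV.B and eq. (9), p. 6, 8] -/
theorem approxDesign_certification_lower_bound_flat [Nontrivial V] {ψ : J → V → ℂ} {εd : ℝ}
    (hψ : IsRelApproxStateTwoDesign εd ψ) (hεd : 0 ≤ εd)
    (hflat : ∀ j, ∃ S : Finset V, S.Nonempty ∧ designDist ψ j = flatOn S)
    {ε δ : ℝ} (hε : 0 < ε) (hε2 : ε ≤ 1 / 2) (hδ : 0 < δ)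
    (hfit : 2 * ε + (2 : ℝ) ^ (-Real.logb 2 (Fintype.card V) / 2) *
      (δ / (2 * (1 + εd))) ^ (-(1 / 2) : ℝ) ≤ 1) :
    ((univ.filter (fun j : J =>
        ¬ (∀ (s : ℕ) (T : (Fin s → V) → Bool), IsCertTest (designDist ψ j) ε s T →
          (1 / 8 : ℝ) * ((2 : ℝ) ^ (Real.logb 2 (Fintype.card V) / 4) * (δ / (2 * (1 + εd))) ^ (1 / 4 : ℝ) *
            (1 - 2 * ε - (2 : ℝ) ^ (-Real.logb 2 (Fintype.card V) / 2) *
              (δ / (2 * (1 + εd))) ^ (-(1 / 2) : ℝ)) ^ (3 / 2 : ℝ)) / ε ^ 2 ≤ s))).card : ℝ) /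
      (Fintype.card J : ℝ) ≤ δ := by
  refine approxDesign_certification_lower_bound hψ hεd (by norm_num) hε hδ hfit fun j => ?_
  obtain ⟨S, hS, h⟩ := hflat j
  rw [h]
  exact vvLowerBoundAt_flatOn_of_nonempty hS hε hε2

open Classical in
/-- **The exact-design theorem is the `ε̃ = 0` case**: for an exact 2-design the tree's
`twoDesign_certification_lower_bound` follows from `approxDesign_certification_lower_bound` via
`IsStateTwoDesign.isRelApprox` (sanity check of the interface; `δ/(2(1+0)) = δ/2`).
[cite: HangleiterEtAl2019, Theorem 7(b) eq. (28), p. 8] -/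
theorem twoDesign_certification_lower_bound' {ψ : J → V → ℂ} (hψ : IsStateTwoDesign ψ)
    {c₂ ε δ : ℝ} (hc : 0 ≤ c₂) (hε : 0 < ε) (hδ : 0 < δ)
    (hfit : 2 * ε + (2 : ℝ) ^ (-Real.logb 2 (Fintype.card V) / 2) *
      (δ / 2) ^ (-(1 / 2) : ℝ) ≤ 1)
    (hVV : ∀ j, VVLowerBoundAt c₂ ε (designDist ψ j)) :
    ((univ.filter (fun j : J =>
        ¬ (∀ (s : ℕ) (T : (Fin s → V) → Bool), IsCertTest (designDist ψ j) ε s T →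
          c₂ * ((2 : ℝ) ^ (Real.logb 2 (Fintype.card V) / 4) * (δ / 2) ^ (1 / 4 : ℝ) *
            (1 - 2 * ε - (2 : ℝ) ^ (-Real.logb 2 (Fintype.card V) / 2) *
              (δ / 2) ^ (-(1 / 2) : ℝ)) ^ (3 / 2 : ℝ)) / ε ^ 2 ≤ s))).card : ℝ) /
      (Fintype.card J : ℝ) ≤ δ := by
  have key := approxDesign_certification_lower_bound (hψ.isRelApprox le_rfl) le_rfl hc hε hδ
    (by rw [add_zero, mul_one]; exact hfit) hVV
  simp only [add_zero, mul_one] at key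
  exact key

/-! ### (v3) Theorem 7(b) for relative approximate 2-designs — UNCONDITIONAL (Valiant–Valiant discharged,
`Certification.vvLowerBoundAt_holds`, v11 of `CertificationSampleComplexity.lean`) -/

section unconditional

open Classical in
/-- **Theorem 7(b) for relative `ε̃`-approximate spherical 2-designs — UNCONDITIONAL** (`c₂ = 1/11`;
Valiant–Valiant's Theorem 2 is the tree's `Certification.vvLowerBoundAt_holds`, (33) comes from the
definition): for a finite relative `ε̃`-approximate state 2-design `{ψ_j}` in `ℂ^V` (`|V| ≥ 2`), `0 < ε`,
`0 < δ` and “sufficiently large `n`” (`hfit`), the fraction of `j` whose output distribution admits an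
`ε`-certification test from fewer than
`(1/11)·2^{(log₂N)/4} q^{1/4} (1 − 2ε − 2^{−(log₂N)/2} q^{−1/2})^{3/2}/ε²` samples, `q = δ/(2(1+ε̃))`, is at most
`δ` — eq. (28), `s_min ∈ Ω(2^{n/4}δ^{1/4}/(ϵ²(1+ε̃)^{1/4}))`; the only statement left outside the tree towards
“depth-`O(n²)` local random universal circuits” is that such circuits ARE relative `ε̃`-approximate designs
(Brandão–Harrow–Horodecki, Corollary 6). [cite: HangleiterEtAl2019, Theorem 7(b) eq. (28) and §V.B eqs. (33)–(34), p. 8–9] [cite: ValiantValiant2017, Thm. 1 (lower bound)] -/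
theorem approxDesign_certification_lower_bound_holds [Nontrivial V] {ψ : J → V → ℂ} {εd : ℝ}
    (hψ : IsRelApproxStateTwoDesign εd ψ) (hεd : 0 ≤ εd) {ε δ : ℝ} (hε : 0 < ε) (hδ : 0 < δ)
    (hfit : 2 * ε + (2 : ℝ) ^ (-Real.logb 2 (Fintype.card V) / 2) *
      (δ / (2 * (1 + εd))) ^ (-(1 / 2) : ℝ) ≤ 1) :
    ((univ.filter (fun j : J =>
        ¬ (∀ (s : ℕ) (T : (Fin s → V) → Bool), IsCertTest (designDist ψ j) ε s T →
          (1 / 11 : ℝ) * ((2 : ℝ) ^ (Real.logb 2 (Fintype.card V) / 4) *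
            (δ / (2 * (1 + εd))) ^ (1 / 4 : ℝ) *
            (1 - 2 * ε - (2 : ℝ) ^ (-Real.logb 2 (Fintype.card V) / 2) *
              (δ / (2 * (1 + εd))) ^ (-(1 / 2) : ℝ)) ^ (3 / 2 : ℝ)) / ε ^ 2 ≤ s))).card : ℝ) /
      (Fintype.card J : ℝ) ≤ δ := by
  have hpos : 0 < (2 : ℝ) ^ (-Real.logb 2 (Fintype.card V) / 2) *
      (δ / (2 * (1 + εd))) ^ (-(1 / 2) : ℝ) :=
    mul_pos (Real.rpow_pos_of_pos (by norm_num) _) (Real.rpow_pos_of_pos (by positivity) _)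
  have hε2 : ε ≤ 1 / 2 := by linarith
  exact approxDesign_certification_lower_bound hψ hεd (by norm_num) hε hδ hfit
    fun j => vvLowerBoundAt_holds _ (designDist_nonneg ψ j) (hψ.norm_sq j) hε hε2

end unconditional

/-! ### (v2) Relative 2-designs are relative 1-designs; Theorem 5 of Hangleiter–Bermejo-Vega–Schwarz–Eisert
for relative approximate STATE 2-designs (closing DesignAnticoncentration's “TODO(general form)”) -/

section anticoncentration
omit [Nonempty V] [Nonempty J]

omit [Fintype V] [DecidableEq V] in
/-- The `(xc,xc)` entries of `M(ψ)`: `(1/K) Σ_j |ψ_j(x)|²|ψ_j(c)|²`. [cite: HangleiterEtAl2018, Theorem 5 (proof: moments `l = 2, 4` of a relative 2-design)] -/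
theorem avgTwoCopy_diag₂ (ψ : J → V → ℂ) (x c : V) :
    avgTwoCopy ψ (x, c) (x, c) =
      ((((Fintype.card J : ℝ))⁻¹ * ∑ j, Complex.normSq (ψ j x) * Complex.normSq (ψ j c) : ℝ) : ℂ) := by
  rw [avgTwoCopy, Matrix.smul_apply, Matrix.sum_apply, smul_eq_mul]
  simp_rw [proj_kron_diag']
  push_cast
  rfl

/-- The `(xc,xc)` entries of the Haar value: `(1 + [x = c])/(N(N+1))`. [cite: ZhuEtAl2016, §2 Proposition 1] -/
theorem haarTwoCopy_diag₂ (x c : V) :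
    haarTwoCopy V (x, c) (x, c) =
      (((1 + if x = c then 1 else 0) / ((Fintype.card V : ℝ) * (Fintype.card V + 1)) : ℝ) : ℂ) := by
  rw [haarTwoCopy, Matrix.smul_apply, Matrix.add_apply, Matrix.one_apply_eq, swapOp, Matrix.of_apply,
    smul_eq_mul]
  by_cases h : x = c
  · subst h; rw [if_pos ⟨rfl, rfl⟩, if_pos rfl]; push_cast; ring
  · rw [if_neg (fun hh => h hh.1), if_neg h]; push_cast; ring

/-- Row sums of the Haar value over the second copy: `Σ_c (1 + [x = c])/(N(N+1)) = 1/N`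
(the partial trace `Tr₂ (𝟙 + F)/(N(N+1)) = 𝟙/N`). [cite: HangleiterEtAl2018, App. (“k-designs are (k−1)-designs”), Theorem 5 proof] -/
theorem sum_haarTwoCopy_diag₂ [Nonempty V] (x : V) :
    ∑ c, (1 + if x = c then (1 : ℝ) else 0) / ((Fintype.card V : ℝ) * (Fintype.card V + 1)) =
      1 / (Fintype.card V : ℝ) := by
  have hN : (0 : ℝ) < Fintype.card V := by exact_mod_cast Fintype.card_pos
  rw [← sum_div, sum_add_distrib, sum_const, card_univ, nsmul_eq_mul, mul_one, sum_ite_eq univ x,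
    if_pos (mem_univ x)]
  field_simp

/-- **A relative `ε̃`-approximate 2-design is a relative `ε̃`-approximate 1-design** (upper half):
`(1/K) Σ_j |⟨x|ψ_j⟩|² ≤ (1 + ε̃)/N` — summing the nonnegative diagonal of `(1+ε̃)·Haar − M` over the
second copy. [cite: HangleiterEtAl2018, Theorem 5 (proof, display “(1−ϵ)E_Haar[|⟨a|U|b⟩|^l] ≤ E_μ[…] ≤ (1+ϵ)E_Haar[…], l = 2, 4”) and App. (k-designs are (k−1)-designs)] -/
theorem IsRelApproxStateTwoDesign.second_moment_le_at [Nonempty V] {ψ : J → V → ℂ} {εd : ℝ}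
    (h : IsRelApproxStateTwoDesign εd ψ) (x : V) :
    ((Fintype.card J : ℝ))⁻¹ * ∑ j, Complex.normSq (ψ j x) ≤ (1 + εd) / (Fintype.card V : ℝ) := by
  have hrow : ∀ c : V, ((Fintype.card J : ℝ))⁻¹ * ∑ j, Complex.normSq (ψ j x) * Complex.normSq (ψ j c) ≤
      (1 + εd) * ((1 + if x = c then (1 : ℝ) else 0) / ((Fintype.card V : ℝ) * (Fintype.card V + 1))) := by
    intro c
    have hd := h.upper.diag_nonneg (i := ((x, c) : V × V))
    rw [Matrix.sub_apply, Matrix.smul_apply, haarTwoCopy_diag₂, avgTwoCopy_diag₂, smul_eq_mul,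
      ← Complex.ofReal_mul, ← Complex.ofReal_sub, Complex.zero_le_real] at hd
    linarith
  have hsum := sum_le_sum fun c (_ : c ∈ univ) => hrow c
  rw [← mul_sum, ← mul_sum, sum_haarTwoCopy_diag₂] at hsum
  have e : ∑ c, ∑ j, Complex.normSq (ψ j x) * Complex.normSq (ψ j c) = ∑ j, Complex.normSq (ψ j x) := by
    rw [sum_comm]
    exact sum_congr rfl fun j _ => by rw [← mul_sum, h.norm_sq j, mul_one]
  rw [e] at hsum
  calc ((Fintype.card J : ℝ))⁻¹ * ∑ j, Complex.normSq (ψ j x) ≤ (1 + εd) * (1 / (Fintype.card V : ℝ)) := hsum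
    _ = (1 + εd) / (Fintype.card V : ℝ) := by ring

/-- … and the lower half `(1 − ε̃)/N ≤ (1/K) Σ_j |⟨x|ψ_j⟩|²`. [cite: HangleiterEtAl2018, Theorem 5 (proof, l = 2) and App.] -/
theorem IsRelApproxStateTwoDesign.second_moment_ge_at [Nonempty V] {ψ : J → V → ℂ} {εd : ℝ}
    (h : IsRelApproxStateTwoDesign εd ψ) (x : V) :
    (1 - εd) / (Fintype.card V : ℝ) ≤ ((Fintype.card J : ℝ))⁻¹ * ∑ j, Complex.normSq (ψ j x) := by
  have hrow : ∀ c : V, (1 - εd) * ((1 + if x = c then (1 : ℝ) else 0) / ((Fintype.card V : ℝ) * (Fintype.card V + 1))) ≤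
      ((Fintype.card J : ℝ))⁻¹ * ∑ j, Complex.normSq (ψ j x) * Complex.normSq (ψ j c) := by
    intro c
    have hd := h.lower.diag_nonneg (i := ((x, c) : V × V))
    rw [Matrix.sub_apply, Matrix.smul_apply, haarTwoCopy_diag₂, avgTwoCopy_diag₂, smul_eq_mul,
      ← Complex.ofReal_mul, ← Complex.ofReal_sub, Complex.zero_le_real] at hd
    linarith
  have hsum := sum_le_sum fun c (_ : c ∈ univ) => hrow c
  rw [← mul_sum, ← mul_sum, sum_haarTwoCopy_diag₂] at hsum
  have e : ∑ c, ∑ j, Complex.normSq (ψ j x) * Complex.normSq (ψ j c) = ∑ j, Complex.normSq (ψ j x) := by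
    rw [sum_comm]
    exact sum_congr rfl fun j _ => by rw [← mul_sum, h.norm_sq j, mul_one]
  rw [e] at hsum
  calc (1 - εd) / (Fintype.card V : ℝ) = (1 - εd) * (1 / (Fintype.card V : ℝ)) := by ring
    _ ≤ _ := hsum

open Classical in
/-- **Theorem 5 of Hangleiter–Bermejo-Vega–Schwarz–Eisert for relative `ε̃`-approximate STATE
2-designs** (“Theorem 5 also holds in exactly the same way for relative ϵ-approximate state 2-designs”):
for `0 ≤ ε̃ < 1`, `0 ≤ α ≤ 1` and every outcome `x`, the fraction of design states with
`|⟨x|ψ_j⟩|² > α(1 − ε̃)/N` is at least `(1 − α)²(1 − ε̃)²/(2(1 + ε̃))` — the tree's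
`anticoncentration_of_moment_bounds` (Theorem 5 from the two moment bounds) with BOTH moment bounds now
DISCHARGED from the operator-inequality definition (`second_moment_ge_at`, `fourth_moment_le`), closing
that file's “TODO(general form)”. (`ε̃ < 1` as there: for `ε̃ ≥ 1` the printed bound is not a statement
about a probability.) [cite: HangleiterEtAl2018, Theorem 5 and Definition 3 (relative ϵ-approximate unitary k-design: “(1−ϵ)M_Haar ≤ M_μ ≤ (1+ϵ)M_Haar”)] -/
theorem IsRelApproxStateTwoDesign.anticoncentration [Nonempty V] {ψ : J → V → ℂ} {εd : ℝ}
    (h : IsRelApproxStateTwoDesign εd ψ) (hε0 : 0 ≤ εd) (hε1 : εd < 1) {α : ℝ} (hα0 : 0 ≤ α)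
    (hα1 : α ≤ 1) (x : V) :
    (1 - α) ^ 2 * (1 - εd) ^ 2 / (2 * (1 + εd)) ≤
      ((univ.filter fun j : J => α * (1 - εd) / (Fintype.card V : ℝ) < Complex.normSq (ψ j x)).card : ℝ) /
        (Fintype.card J : ℝ) := by
  have hK : (0 : ℝ) < Fintype.card J := by exact_mod_cast h.card_pos hε1 x
  have hμ1 : ∑ _j : J, ((Fintype.card J : ℝ))⁻¹ = 1 := by
    rw [sum_const, card_univ, nsmul_eq_mul, mul_inv_cancel₀ hK.ne']
  have key := anticoncentration_of_moment_bounds (fun _ : J => ((Fintype.card J : ℝ))⁻¹)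
    (fun j => Complex.normSq (ψ j x)) (fun _ => by positivity) hμ1 Fintype.card_pos hε0 hε1 hα0 hα1
    (by rw [← mul_sum]; exact h.second_moment_ge_at x)
    (by rw [← mul_sum, show (1 + εd) * (2 / ((Fintype.card V : ℝ) * (Fintype.card V + 1))) =
          2 * (1 + εd) / ((Fintype.card V : ℝ) * (Fintype.card V + 1)) by ring]
        exact h.fourth_moment_le x)
  rw [sum_const, nsmul_eq_mul] at key
  rw [div_eq_mul_inv]
  exact key

end anticoncentration

end ApproximateStateDesign
end Literature.Computability.QuantumComplexity
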